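import Literature.AlgebraicGeometry.Motives.HodgeStructureExteriorPowerOverField
import Literature.AlgebraicGeometry.Motives.HodgeStructureHalfTwistAbelianType
import Literature.AlgebraicGeometry.Motives.HodgeStructureExteriorPowerTensorPower
import Literature.AlgebraicGeometry.Motives.HodgeStructureAbelianTypeTensorPower
import Literature.AlgebraicGeometry.Motives.HodgeStructureAbelianTypeSubobjects
import Literature.AlgebraicGeometry.Motives.HodgeStructureProdPolarization
import Literature.AlgebraicGeometry.Motives.HodgeTensorFactsHolds
import Literature.AlgebraicGeometry.HodgeTheory.WeightOneHodgeStructuresRealisedByTori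
import HarnessLib

/-!
# `⋀^i_E V`, its half twists and van Geemen's `S_i = (⋀^i_K V)(i-1)_{1/2}` are polarizable and of abelian type when `V` is

[topic AlgebraicGeometry/Motives]

Layer `Literature/AlgebraicGeometry/Motives`, lane `lit-hodgefound` (Track 2 foundations library; prover seat `lit-hodgefound-p26`).
THEOREMS ONLY (no definition, no named fact, net debt `0`): the sibling of `Motives/HodgeStructureExteriorPowerOverField`
(Weil's `⋀^i_E V ⊂ ⋀^i_ℚ V` as the sub-Hodge structure `EndAction.weilPowerSub`, its `E`-action `weilPowerAction`, and, for an
imaginary quadratic `K` and `V` of K3 type, van Geemen's weight-one structures `S_i := (⋀^i_K V)(i-1)_{1/2} = EndAction.weilPowerHalfTwist`)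
announced there as "NOT here (iii)": the two standing qualitative properties of these Hodge structures.

## The source

B. van Geemen, *Half twists of Hodge structures of CM-type*, J. Math. Soc. Japan 53 (2001) 813–833 [vanGeemen2001HalfTwists]
(held text `paper:arxiv-math_0008076`). **§3.9** (p0010): "Since `V` is `K`-vector space, the exterior products `∧^i_K V` are
well-defined […] there is a natural inclusion `∧^i_K V ↪ ∧^i V`, and the `∧^i_K V` are sub-Hodge structures of `∧^i V` of weight
`2i`. Combining Tate and half twists of these, one obtains weight 1 Hodge structures which are the summands of the Kuga-Satake
Hodge structure." **Thm. 3.10**: "Let `(V,h,ψ)` be a polarized weight `2` Hodge structure with `dim V^{2,0} = 1` which is of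
CM-type for an imaginary quadratic field `K`. Then the Hodge structure on the summand `S_i` […] of the Kuga-Satake Hodge structure
is: `S_i ≅ (∧_K^i V)(i-1)_{1/2}`. In particular, `S_1 = V_{1/2}`". **§2.9**: "if `V` is of CM-type […] then `V_{-1/2}` is a
sub-Hodge structure of `V ⊗ K_{-1/2}`. Therefore `V_{1/2}` is 'abelian' if `V` is […]". **§2.11**: "If `V` has a
polarization, then also `V ⊗ K_{-1/2}` has a polarization […] and by restriction one obtains a polarization on `V_{1/2}`."
The Kuga–Satake Hodge structure `(C⁺(V), h_s)` is the `H¹` of an abelian variety (van Geemen §3; Deligne, Invent. Math. 15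
(1972) §3–5), so its summands `S_i` are POLARIZABLE weight-one Hodge structures OF ABELIAN TYPE. This file proves these two
properties of the right-hand side `(∧^i_K V)(i-1)_{1/2}` intrinsically, from the corresponding properties of `V`
(sub-Hodge structures, exterior powers, Tate twists and half twists preserve polarizability — Deligne, Hodge II, 2.1.15;
Voisin I, Lemma 7.26 — and abelian type — André 1996 §6.1 / Moonen 2017 §3; van Geemen §2.9), for every `i ≥ 1`.

## What is formalized

* §1 (any weight `n`, any number field `E`, any `i`): **`EndAction.isPolarizable_weilPowerSub`** (`V` polarizable ⟹ `⋀^i_E V`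
  polarizable) and **`EndAction.isOfAbelianType_weilPowerSub`** (`V` of abelian type ⟹ `⋀^i_E V` of abelian type).
* §2 (`E` a CM field, `V E : Type`): the half twists `(⋀^i_E V){-b/2}_Θ` (`(weilPowerAction i hi).halfTwist Θ b`) are polarizable,
  resp. of abelian type, when `V` is (`isPolarizable_halfTwist_weilPowerSub`, `isOfAbelianType_halfTwist_weilPowerSub`).
* §3 (`V` of weight `2`, `E` a CM field, `i ≥ 1`): **`isPolarizable_weilPowerHalfTwist`**, **`isOfAbelianType_weilPowerHalfTwist`**
  — van Geemen's `S_i = (⋀^i_K V)(i-1)_{1/2}` is polarizable, resp. of abelian type, when `V` is; and for `S_1 = V_{1/2}`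
  (`[K:ℚ] = 2`) the converses **`isPolarizable_weilPowerHalfTwist_one_iff`**, **`isOfAbelianType_weilPowerHalfTwist_one_iff`**
  (through the isomorphism `halfTwistHomWeilPowerHalfTwistOne : V_{1/2} ⥲ S_1` and van Geemen's §2.5/§2.11 equivalences
  `isPolarizable_halfTwist_iff`, `isOfAbelianType_halfTwist_iff`).
* §4 (`V` of K3 type, polarized, `[K:ℚ] = 2`, `Θ = {σ₀}`, `V^{2,0} ⊂ V_{σ₀}`, `1 ≤ i ≤ m = dim_K V`):
  **`exists_isAbelianVariety_hom_weilPowerHalfTwist_bijective`** — `S_i ≅ H¹(X_i, ℚ)` in `Hod_ℚ` for a complex torus `X_i`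
  admitting a Riemann form (`ComplexTorus.IsAbelianVariety`), by the sibling file's effectivity `isEffective_weilPowerHalfTwist`,
  §3, `nontrivial_weilPower` (`⋀^i_E V ≠ 0` for `i ≤ dim_E V`) and Riemann's theorem at torus level
  (`HodgeTheory.isEffective_and_isPolarizable_iff_exists_abelianVariety_hom_bijective`): the `S_i` ARE first cohomology groups of
  abelian varieties ("the summands of the Kuga-Satake Hodge structure" are such); rider r1:
  `exists_isAbelianVariety_hom_weilPowerHalfTwist_bijective_dim` pins the dimension of the torus, `dim X_i = C(m, i)`,
  `m = dim_K V` ("they have dimension `2 (m choose i)`").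

SCOPE. For `V` of K3 type the hypothesis "`V` is of abelian type" IS the Kuga–Satake theorem (tree: `Motives/KugaSatake*`); it is
an INPUT here, not reproved, and the identification of `(∧^i_K V)(i-1)_{1/2}` with the summand `S_i` of `C⁺(V)` (Prop. 3.6/3.8) is
not made (as in the sibling file). NOT here: the explicit `K`-compatible polarization `Ψ(v, αw)` of §2.11 on `S_i`
(`Motives/HodgeStructureHalfTwistPolarization`) and the `E`-compatibility of the exterior-power polarization on `⋀^i_E V`.
-- TODO(general form): none beyond the above.

## References

* [vanGeemen2001HalfTwists] B. van Geemen, *Half twists of Hodge structures of CM-type*, J. Math. Soc. Japan 53 (2001) 813–833: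
  §2.9, §2.11, §3.9, Thm. 3.10 (p0005, p0010 of `arXiv:math/0008076`).
* [DeligneHodgeII1971] P. Deligne, *Théorie de Hodge II*, Publ. Math. IHÉS 40 (1971): 2.1.15.
* [VoisinHodgeI2002] C. Voisin, *Hodge Theory and Complex Algebraic Geometry I*, CUP (2002): Lemma 7.26, §7.3.1.
* [Andre1996Motifs] Y. André, *Pour une théorie inconditionnelle des motifs*, Publ. Math. IHÉS 83 (1996): §6.1.
* [DeligneMilne1982Tannakian] P. Deligne, J. S. Milne, *Tannakian categories*, in LNM 900 (1982): Thm. 6.20 (Riemann), p. 212.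
-/

noncomputable section

open scoped TensorProduct

open Module NumberField

namespace Literature.AlgebraicGeometry.Motives

namespace HodgeStructure

namespace EndAction

universe u

/-! ## §1 `⋀^i_E V` is polarizable / of abelian type when `V` is -/

section WeilPowerSub

variable {V : Type u} [AddCommGroup V] [Module ℚ V] [Module.Finite ℚ V] {n : ℤ} {E : Type*} [Field E] [NumberField E]
  {H : HodgeStructure V n} (A : EndAction H E)

/-- **`⋀^i_E V` is polarizable when `V` is**: a sub-Hodge structure (`weilPowerSub`) of the polarizable `⋀^i_ℚ V`
(`IsPolarizable.exteriorPower`) is polarizable by restriction. [cite: vanGeemen2001HalfTwists, §3.9 ("the ∧^i_K V are sub-Hodge structures of ∧^i V")] [cite: DeligneHodgeII1971, 2.1.15] [cite: VoisinHodgeI2002, Lemma 7.26] -/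
theorem isPolarizable_weilPowerSub (hH : H.IsPolarizable) (i : ℕ) :
    (A.weilPowerSub i).toHodgeStructure.IsPolarizable :=
  SubHodgeStructure.isPolarizable (hH.exteriorPower i) (A.weilPowerSub i)

omit [Module.Finite ℚ V] in
/-- **`⋀^i_E V` is of abelian type when `V` is**: a sub-Hodge structure of the abelian-type `⋀^i_ℚ V`
(`IsOfAbelianType.exteriorPower`, a direct summand of `V^{⊗ i}`) is of abelian type (`IsOfAbelianType.subHodgeStructure`).
[cite: vanGeemen2001HalfTwists, §3.9 and §2.9] [cite: Andre1996Motifs, §6.1] -/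
theorem isOfAbelianType_weilPowerSub (hH : H.IsOfAbelianType) (i : ℕ) :
    (A.weilPowerSub i).toHodgeStructure.IsOfAbelianType := by
  haveI : HodgeTensorFacts.{u, u} := hodgeTensorFacts_holds.{u, u}
  exact (hH.exteriorPower i).subHodgeStructure (A.weilPowerSub i)

/-- `⋀^i_E V ≠ 0` for `1 ≤ i ≤ dim_E V` (`dim_ℚ ⋀^i_E V = [E:ℚ] · C(dim_ℚ V / [E:ℚ], i)`, the sibling file's
`finrank_weilPower'`). [cite: vanGeemen2001HalfTwists, §3.9 ("they have dimension 2 (m choose i)")] -/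
theorem nontrivial_weilPower {i : ℕ} (hi : i ≠ 0) (him : i ≤ Module.finrank ℚ V / Module.finrank ℚ E) :
    Nontrivial (A.weilPower i) := by
  apply Module.nontrivial_of_finrank_pos (R := ℚ)
  rw [A.finrank_weilPower' i hi]
  exact Nat.mul_pos Module.finrank_pos (Nat.choose_pos him)

end WeilPowerSub

/-! ## §2 The half twists of `⋀^i_E V` -/

section HalfTwists

variable {V : Type} [AddCommGroup V] [Module ℚ V] [Module.Finite ℚ V] {n : ℤ} {E : Type} [Field E] [NumberField E]
  [IsCMField E] {H : HodgeStructure V n} (A : EndAction H E) (Θ : CMType E) (i : ℕ) (hi : i ≠ 0)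

/-- **`(⋀^i_E V){-b/2}_Θ` is polarizable when `V` is** (half twists preserve polarizability, van Geemen §2.11, applied to the
`E`-Hodge structure `(⋀^i_E V, weilPowerAction)`). [cite: vanGeemen2001HalfTwists, §2.11 and §3.9] [cite: DeligneHodgeII1971, 2.1.15] -/
theorem isPolarizable_halfTwist_weilPowerSub (hH : H.IsPolarizable) (b : ℤ) :
    ((A.weilPowerAction i hi).halfTwist Θ b).IsPolarizable :=
  (A.isPolarizable_weilPowerSub hH i).halfTwist (A.weilPowerAction i hi) Θ b

omit [Module.Finite ℚ V] in
/-- **`(⋀^i_E V){-b/2}_Θ` is of abelian type when `V` is** (van Geemen §2.9 "V_{1/2} is 'abelian' if V is", applied to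
`⋀^i_E V`). [cite: vanGeemen2001HalfTwists, §2.9 and §3.9] -/
theorem isOfAbelianType_halfTwist_weilPowerSub (hH : H.IsOfAbelianType) (b : ℤ) :
    ((A.weilPowerAction i hi).halfTwist Θ b).IsOfAbelianType :=
  (A.isOfAbelianType_weilPowerSub hH i).halfTwist (A.weilPowerAction i hi) Θ b

end HalfTwists

/-! ## §3 Van Geemen's `S_i = (⋀^i_K V)(i-1)_{1/2}` -/

section KugaSatakeSummands

variable {V : Type} [AddCommGroup V] [Module ℚ V] [Module.Finite ℚ V] {E : Type} [Field E] [NumberField E] [IsCMField E]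
  {H₂ : HodgeStructure V 2} (A₂ : EndAction H₂ E) (Θ : CMType E) {σ₀ : E →+* ℂ} (i : ℕ) (hi : i ≠ 0)

/-- **`S_i = (⋀^i_K V)(i-1)_{1/2}` IS POLARIZABLE when `V` is** ("Combining Tate and half twists of these, one obtains weight 1
Hodge structures which are the summands of the Kuga-Satake Hodge structure" — polarizability of the right-hand side of
Thm. 3.10, for every CM field `E` and every `i ≥ 1`). [cite: vanGeemen2001HalfTwists, §3.9, Thm. 3.10 and §2.11] [cite: DeligneHodgeII1971, 2.1.15] -/
theorem isPolarizable_weilPowerHalfTwist (hH : H₂.IsPolarizable) : (A₂.weilPowerHalfTwist Θ i hi).IsPolarizable :=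
  ((A₂.isPolarizable_halfTwist_weilPowerSub Θ i hi hH (-1)).tateTwist ((i : ℤ) - 1)).cast _

omit [Module.Finite ℚ V] in
/-- **`S_i = (⋀^i_K V)(i-1)_{1/2}` IS OF ABELIAN TYPE when `V` is** (the summands of the Kuga–Satake Hodge structure are `H¹`'s of
abelian varieties up to isogeny; here: the right-hand side of Thm. 3.10 is of abelian type whenever `V` is — for `V` of K3 type
this hypothesis is the Kuga–Satake theorem). [cite: vanGeemen2001HalfTwists, §3.9, Thm. 3.10 and §2.9] [cite: Andre1996Motifs, §6.1] -/
theorem isOfAbelianType_weilPowerHalfTwist (hH : H₂.IsOfAbelianType) : (A₂.weilPowerHalfTwist Θ i hi).IsOfAbelianType :=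
  ((A₂.isOfAbelianType_halfTwist_weilPowerSub Θ i hi hH (-1)).tateTwist ((i : ℤ) - 1)).cast _

/-- **`S_1 = V_{1/2}`: `S_1` is polarizable iff `V` is** (`[K:ℚ] = 2`, `Θ = {σ₀}`; through the isomorphism of Hodge structures
`V_{1/2} ⥲ S_1` of the sibling file and van Geemen's "`V_{1/2}` polarizable ⟺ `V` polarizable").
[cite: vanGeemen2001HalfTwists, Thm. 3.10 ("In particular, S_1 = V_{1/2}") and §2.11] -/
theorem isPolarizable_weilPowerHalfTwist_one_iff (h2 : finrank ℚ E = 2) (hσ₀ : σ₀ ∈ Θ.1) :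
    (A₂.weilPowerHalfTwist Θ 1 one_ne_zero).IsPolarizable ↔ H₂.IsPolarizable := by
  refine ⟨fun h => ?_, fun h => A₂.isPolarizable_weilPowerHalfTwist Θ 1 one_ne_zero h⟩
  have h' : ((A₂.halfTwist Θ (-1)).cast (by norm_num : (2 : ℤ) + -1 = 1)).IsPolarizable :=
    h.of_injective (A₂.halfTwistHomWeilPowerHalfTwistOne Θ h2 hσ₀)
      (A₂.halfTwistHomWeilPowerHalfTwistOne_bijective Θ h2 hσ₀).1
  exact (isPolarizable_halfTwist_iff A₂ Θ (-1)).1 (IsPolarizable.of_cast _ h')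

/-- **`S_1 = V_{1/2}`: `S_1` is of abelian type iff `V` is** (`[K:ℚ] = 2`; van Geemen §2.9 "`V_{1/2}` is 'abelian' if `V` is.
Conversely, if `V_{1/2}` is 'abelian' then so is […] `V`"). [cite: vanGeemen2001HalfTwists, Thm. 3.10 ("S_1 = V_{1/2}") and §2.9] -/
theorem isOfAbelianType_weilPowerHalfTwist_one_iff (h2 : finrank ℚ E = 2) (hσ₀ : σ₀ ∈ Θ.1) :
    (A₂.weilPowerHalfTwist Θ 1 one_ne_zero).IsOfAbelianType ↔ H₂.IsOfAbelianType := by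
  refine ⟨fun h => ?_, fun h => A₂.isOfAbelianType_weilPowerHalfTwist Θ 1 one_ne_zero h⟩
  have h' : ((A₂.halfTwist Θ (-1)).cast (by norm_num : (2 : ℤ) + -1 = 1)).IsOfAbelianType :=
    h.of_injective (A₂.halfTwistHomWeilPowerHalfTwistOne Θ h2 hσ₀)
      (A₂.halfTwistHomWeilPowerHalfTwistOne_bijective Θ h2 hσ₀).1
  exact (isOfAbelianType_halfTwist_iff A₂ Θ (-1)).1 (IsOfAbelianType.of_cast _ h')

end KugaSatakeSummands

/-! ## §4 `S_i ≅ H¹(X_i, ℚ)` for an abelian variety `X_i` (Riemann) -/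

section Riemann

variable {V : Type} [AddCommGroup V] [Module ℚ V] [Module.Finite ℚ V] {E : Type} [Field E] [NumberField E] [IsCMField E]
  {H₂ : HodgeStructure V 2} (A₂ : EndAction H₂ E) (Θ : CMType E) {σ₀ : E →+* ℂ} (i : ℕ) (hi : i ≠ 0)

/-- **`S_i ≅ H¹(X_i, ℚ)` FOR A COMPLEX ABELIAN VARIETY `X_i`** ("one obtains weight 1 Hodge structures which are the summands of the
Kuga-Satake Hodge structure" — i.e. first cohomology of abelian varieties, the isogeny factors of the Kuga–Satake variety): for
`V` of K3 type, polarized, of CM-type for an imaginary quadratic `K` (`Θ = {σ₀}`, `V^{2,0} ⊂ V_{σ₀}`) and `1 ≤ i ≤ m = dim_K V`,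
the effective (`isEffective_weilPowerHalfTwist`) polarizable (`isPolarizable_weilPowerHalfTwist`) weight-one structure
`S_i = (⋀^i_K V)(i-1)_{1/2}` is isomorphic in `Hod_ℚ` to `H¹(X, ℚ)` of a complex torus `X = ℂ^m'/Λ` admitting a Riemann form
(the tree's `ComplexTorus.IsAbelianVariety`), by Riemann's theorem at torus level (the tree's
`HodgeTheory.isEffective_and_isPolarizable_iff_exists_abelianVariety_hom_bijective`). The identification of `X_i` with an
isogeny factor of the Kuga–Satake variety of `(V, ψ)` is NOT made here.
[cite: vanGeemen2001HalfTwists, §3.9 and Thm. 3.10] [cite: DeligneMilne1982Tannakian, §6 Thm. 6.20 (Riemann), p. 212] -/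
theorem exists_isAbelianVariety_hom_weilPowerHalfTwist_bijective (hK3 : H₂.IsOfK3Type) (h2 : finrank ℚ E = 2)
    (hσ₀ : σ₀ ∈ Θ.1) (hplus : H₂.piece 2 0 ≤ ⨅ e, Module.End.eigenspace ((A₂.ι e).baseChange ℂ) (σ₀ e))
    (hH : H₂.IsPolarizable) (him : i ≤ Module.finrank ℚ V / 2) :
    ∃ (m : ℕ) (Φ : (Fin (Module.finrank ℚ (A₂.weilPower i)) → ℝ) ≃L[ℝ] (Fin m → ℂ)),
      Literature.Geometry.Kaehler.ComplexTorus.IsAbelianVariety Φ ∧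
        ∃ f : Hom (Literature.Geometry.Kaehler.ComplexTorus.hodgeStructure Φ 1) (A₂.weilPowerHalfTwist Θ i hi),
          Function.Bijective f.toLinearMap := by
  haveI : HodgeTensorFacts.{0, 0} := hodgeTensorFacts_holds.{0, 0}
  haveI : Nontrivial (A₂.weilPower i) := A₂.nontrivial_weilPower hi (by rwa [h2])
  exact (Literature.AlgebraicGeometry.HodgeTheory.isEffective_and_isPolarizable_iff_exists_abelianVariety_hom_bijective
    (A₂.weilPowerHalfTwist Θ i hi)).1
    ⟨A₂.isEffective_weilPowerHalfTwist Θ i hK3 h2 hσ₀ hplus hi, A₂.isPolarizable_weilPowerHalfTwist Θ i hi hH⟩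

/-- **`S_i ≅ H¹(X_i, ℚ)` with `dim X_i = C(m, i)`, `m = dim_K V`** ("as `ℚ`-vector spaces, they have dimension `2 (m choose i)`,
which is just the dimension of the summand `S_i`"): the complex torus of `exists_isAbelianVariety_hom_weilPowerHalfTwist_bijective`
has complex dimension `½ dim_ℚ S_i = ½ · 2 · C(dim_ℚ V / 2, i)` (`finrank_weilPower'`, `[K:ℚ] = 2`; the rank of the lattice of
`X = ℂ^m/Λ` is `2m`, `ComplexTorus.card_eq_two_mul_finrank`). [cite: vanGeemen2001HalfTwists, §3.9 ("they have dimension 2 (m choose i), which is just the dimension of the summand S_i") and Thm. 3.10] [cite: DeligneMilne1982Tannakian, §6 Thm. 6.20 (Riemann), p. 212] -/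
theorem exists_isAbelianVariety_hom_weilPowerHalfTwist_bijective_dim (hK3 : H₂.IsOfK3Type) (h2 : finrank ℚ E = 2)
    (hσ₀ : σ₀ ∈ Θ.1) (hplus : H₂.piece 2 0 ≤ ⨅ e, Module.End.eigenspace ((A₂.ι e).baseChange ℂ) (σ₀ e))
    (hH : H₂.IsPolarizable) (him : i ≤ Module.finrank ℚ V / 2) :
    ∃ (Φ : (Fin (Module.finrank ℚ (A₂.weilPower i)) → ℝ) ≃L[ℝ] (Fin ((Module.finrank ℚ V / 2).choose i) → ℂ)),
      Literature.Geometry.Kaehler.ComplexTorus.IsAbelianVariety Φ ∧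
        ∃ f : Hom (Literature.Geometry.Kaehler.ComplexTorus.hodgeStructure Φ 1) (A₂.weilPowerHalfTwist Θ i hi),
          Function.Bijective f.toLinearMap := by
  obtain ⟨m, Φ, hX, f, hf⟩ := A₂.exists_isAbelianVariety_hom_weilPowerHalfTwist_bijective Θ i hi hK3 h2 hσ₀ hplus hH him
  -- `2 m = rk Λ = dim_ℚ ⋀^i_K V = 2 C(dim_ℚ V / 2, i)`
  have hcard := Literature.Geometry.Kaehler.ComplexTorus.card_eq_two_mul_finrank Φ
  rw [Fintype.card_fin, Module.finrank_fintype_fun_eq_card, Fintype.card_fin, A₂.finrank_weilPower' i hi, h2] at hcard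
  obtain rfl : m = (Module.finrank ℚ V / 2).choose i := by omega
  exact ⟨Φ, hX, f, hf⟩

end Riemann

end EndAction

end HodgeStructure

end Literature.AlgebraicGeometry.Motives
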